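import Summits.Ventures.QEC.Thresholds.DepolarizingThresholds
import Summits.Ventures.QEC.Thresholds.ThresholdConverses
import Literature.InformationTheory.QuantumCodes.DepolarizingCSSConverse
import HarnessLib

/-!
# Depolarizing noise, sector-wise decoding: the certified CEILING `p_c^depol ≤ 3/8` and the EXACT identity
# `p_c^depol = (3/2)·min(p_c^X, p_c^Z)`

Venture QEC, `Summits/Ventures/QEC/Thresholds/` (LADDER-QEC rung Q5, depolarizing column; qec-lit-2 gen 4).
HONEST FRAMING. `DepolarizingThresholds.lean` (qec-type-09) proves the `3/2` RULE: certified sector floors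
`p₀^X, p₀^Z` give the certified depolarizing floor `(3/2)·min(p₀^X, p₀^Z)` for SECTOR-WISE decoding (`D_X` on the
bit-flip part, `D_Z` on the phase-flip part of the depolarizing error). This file adds the converse direction from
`Literature/…/DepolarizingCSSConverse.lean` (`P^Z_{2p/3} ≤ P^depol_p`, `P^X_{2p/3} ≤ P^depol_p`) and the
code-capacity ceilings of `ThresholdConverses.lean`, in the census vocabulary `depolarizingFailureFamily` /
`zFailureFamily` / `xFailureFamily`:

* `depolarizingThreshold_le_three_eighths` — for EVERY family of CSS codes with `k ≥ 1` and EVERY pair of sector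
  decoder families, every certified depolarizing threshold lower bound is `≤ 3/8`
  (`depolarizingAccuracyThreshold_le_three_eighths`: `p_c^depol ≤ 3/8`);
* `zThreshold_of_depolarizingThreshold`, `xThreshold_of_depolarizingThreshold` — a depolarizing floor `a` certifies
  the sector floors `2a/3`;
* ★ `depolarizingAccuracyThreshold_eq` — **`p_c^depol = (3/2)·min(p_c^X, p_c^Z)`** (accuracy thresholds of the
  census families; `k ≥ 1`; any sector decoder families): the depolarizing column of the Q5 table is DETERMINED by
  the two code-capacity columns, floors and ceilings alike;
* toric codes `HGP(circ_L, circ_L)`: `(3/2)·p₀(3) ≤ p_c^depol ≤ 3/8` for minimum-weight sector decoders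
  (`toricHGP_depolarizing_accuracyThreshold_mem`), `≤ 3/8` for every sector decoder pair;
* finite size, every decoder pair: `1/4 ≤ P^depol_{3/8}` for `BB.bb72` (`[[72,12,6]]`) and `BB.bb144`
  (`[[144,12,12]]`) — floors complementing the small-`p` ceilings of `BBDepolarizingBounds.lean`.

Scope: sector-wise decoder pairs only (correlation-aware decoding of depolarizing noise is not covered); no Monte
Carlo number (hashing bound `≈ .189`, MWPM `≈ .155` are VALIDATED-column values, not theorems). Kernel axioms; no
named fact; no `native_decide`; no definition.

## References

* [DennisEtAl2002] E. Dennis, A. Kitaev, A. Landahl, J. Preskill, J. Math. Phys. 43 (2002) 4452, §4.1 (depolarizing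
  channel; X and Z errors corrected separately), §4.6 (`p_c`).
* [DumerKovalevPryadko2015] I. Dumer, A. A. Kovalev, L. P. Pryadko, PRL 115 (2015) 050502, eq.
  (succesful-decoding-depolarizing).
* [RichardsonUrbanke2008] T. Richardson, R. Urbanke, *Modern Coding Theory*, Lemma 4.78 (Erasure Decomposition).
* [BravyiEtAl2024] S. Bravyi et al., Nature 627 (2024) 778, Table 1 (`[[72,12,6]]`, `[[144,12,12]]`).
-/

noncomputable section

namespace Summit.Ventures.QEC.Thresholds

open Filter Topology Finset Matrix
open Literature.InformationTheory.QuantumCodes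

section Families

variable {RX RZ Q : ℕ → Type*} [∀ i, Fintype (Q i)] [∀ i, DecidableEq (Q i)] [∀ i, Fintype (RX i)]
  [∀ i, Fintype (RZ i)]

/-- **`p₀^depol ≤ 3/8`**: for a family of CSS codes with `k ≥ 1` and ANY sector decoder families, every certified
depolarizing threshold lower bound is `≤ 3/8`. [cite: DennisEtAl2002, §4.1; RichardsonUrbanke2008, Lemma 4.78] -/
theorem depolarizingThreshold_le_three_eighths (C : ∀ i, CSSCode (RX i) (RZ i) (Q i)) (hk : ∀ i, 0 < (C i).k)
    (DX : ∀ i, Decoder (RZ i → ZMod 2) (Q i → ZMod 2)) (DZ : ∀ i, Decoder (RX i → ZMod 2) (Q i → ZMod 2))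
    {a : ℝ} (ha : IsThresholdLowerBound (depolarizingFailureFamily C DX DZ) a) : a ≤ 3 / 8 :=
  depolarizing_threshold_le_three_eighths C hk DX DZ ha

/-- **`p_c^depol ≤ 3/8`** (accuracy threshold of the census depolarizing family, sector-wise decoding).
[cite: DennisEtAl2002, §4.1 and §4.6 (p_c)] -/
theorem depolarizingAccuracyThreshold_le_three_eighths (C : ∀ i, CSSCode (RX i) (RZ i) (Q i))
    (hk : ∀ i, 0 < (C i).k) (DX : ∀ i, Decoder (RZ i → ZMod 2) (Q i → ZMod 2))
    (DZ : ∀ i, Decoder (RX i → ZMod 2) (Q i → ZMod 2)) :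
    accuracyThreshold (depolarizingFailureFamily C DX DZ) ≤ 3 / 8 :=
  depolarizing_accuracyThreshold_le_three_eighths C hk DX DZ

/-- **Transfer, `Z`-sector**: a certified depolarizing floor `a` certifies `2a/3` as a phase-flip code-capacity
floor for `DZ`. [cite: DennisEtAl2002, §4.1 (depolarizing channel vs. independent Z errors)] -/
theorem zThreshold_of_depolarizingThreshold (C : ∀ i, CSSCode (RX i) (RZ i) (Q i)) (hk : ∀ i, 0 < (C i).k)
    (DX : ∀ i, Decoder (RZ i → ZMod 2) (Q i → ZMod 2)) (DZ : ∀ i, Decoder (RX i → ZMod 2) (Q i → ZMod 2))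
    {a : ℝ} (ha : IsThresholdLowerBound (depolarizingFailureFamily C DX DZ) a) :
    IsThresholdLowerBound (zFailureFamily C DZ) (2 * a / 3) :=
  isThresholdLowerBound_zFailure_of_depolarizing C hk DX DZ ha

/-- **Transfer, `X`-sector**: a certified depolarizing floor `a` certifies `2a/3` as a bit-flip code-capacity floor
for `DX`. [cite: DennisEtAl2002, §4.1 (depolarizing channel vs. independent X errors)] -/
theorem xThreshold_of_depolarizingThreshold (C : ∀ i, CSSCode (RX i) (RZ i) (Q i)) (hk : ∀ i, 0 < (C i).k)
    (DX : ∀ i, Decoder (RZ i → ZMod 2) (Q i → ZMod 2)) (DZ : ∀ i, Decoder (RX i → ZMod 2) (Q i → ZMod 2))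
    {a : ℝ} (ha : IsThresholdLowerBound (depolarizingFailureFamily C DX DZ) a) :
    IsThresholdLowerBound (xFailureFamily C DX) (2 * a / 3) :=
  isThresholdLowerBound_xFailure_of_depolarizing C hk DX DZ ha

/-- **★ `p_c^depol = (3/2)·min(p_c^X, p_c^Z)` EXACTLY** for sector-wise decoding of any family of CSS codes with
`k ≥ 1` by any sector decoder families `(DX, DZ)`: the `3/2` rule (`depolarizing_isThresholdLowerBound`) gives
`≥`, the transfer of depolarizing floors to sector floors gives `≤`; the side conditions (`min ≤ 2/3`, caps `≤ 1`)
are discharged by the code-capacity ceiling `p_c^X + p_c^Z ≤ 1/2`.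
[cite: DennisEtAl2002, §4.1 (depolarizing channel vs. independent X/Z errors) and §4.6 (p_c)] -/
theorem depolarizingAccuracyThreshold_eq (C : ∀ i, CSSCode (RX i) (RZ i) (Q i)) (hk : ∀ i, 0 < (C i).k)
    (DX : ∀ i, Decoder (RZ i → ZMod 2) (Q i → ZMod 2)) (DZ : ∀ i, Decoder (RX i → ZMod 2) (Q i → ZMod 2)) :
    accuracyThreshold (depolarizingFailureFamily C DX DZ) =
      3 / 2 * min (accuracyThreshold (xFailureFamily C DX)) (accuracyThreshold (zFailureFamily C DZ)) := by
  set A := accuracyThreshold (depolarizingFailureFamily C DX DZ) with hA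
  set aX := accuracyThreshold (xFailureFamily C DX) with haX
  set aZ := accuracyThreshold (zFailureFamily C DZ) with haZ
  have hsum : aZ + aX ≤ 1 / 2 := capacityAccuracyThreshold_sum_le_half C hk DZ DX
  have hX0 : 0 ≤ aX := accuracyThreshold_nonneg _
  have hZ0 : 0 ≤ aZ := accuracyThreshold_nonneg _
  have hmin : min aX aZ ≤ 2 / 3 := by
    have := min_le_left aX aZ
    linarith
  -- `≥`: the 3/2 rule at the accuracy thresholds of the two sectors
  have hge : 3 / 2 * min aX aZ ≤ A :=
    le_accuracyThreshold
      (depolarizing_isThresholdLowerBound C DX DZ (isThresholdLowerBound_accuracyThreshold _)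
        (isThresholdLowerBound_accuracyThreshold _) hmin)
      (by have := min_le_left aX aZ; linarith)
  -- `≤`: transfer of the depolarizing accuracy threshold to each sector
  have hA1 : A ≤ 1 := accuracyThreshold_le_one _
  have hxle : 2 * A / 3 ≤ aX :=
    le_accuracyThreshold (xThreshold_of_depolarizingThreshold C hk DX DZ (isThresholdLowerBound_accuracyThreshold _))
      (by linarith)
  have hzle : 2 * A / 3 ≤ aZ :=
    le_accuracyThreshold (zThreshold_of_depolarizingThreshold C hk DX DZ (isThresholdLowerBound_accuracyThreshold _))
      (by linarith)
  have hle : A ≤ 3 / 2 * min aX aZ := by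
    have := le_min hxle hzle
    linarith
  exact le_antisymm hle hge

end Families

/-! ### Toric codes: `(3/2)·p₀(3) ≤ p_c^depol ≤ 3/8` -/

section Toric

/-- **Toric codes `HGP(circ_L, circ_L)`: every certified depolarizing threshold lower bound is `≤ 3/8`**, for
every pair of sector decoder families. [cite: DennisEtAl2002, §4.1] -/
theorem toricHGP_depolarizing_threshold_le_three_eighths
    (DX : ∀ k, Decoder ((Fin (k + 2) × Fin (k + 2)) → ZMod 2)
      (((Fin (k + 2) × Fin (k + 2)) ⊕ (Fin (k + 2) × Fin (k + 2))) → ZMod 2))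
    (DZ : ∀ k, Decoder ((Fin (k + 2) × Fin (k + 2)) → ZMod 2)
      (((Fin (k + 2) × Fin (k + 2)) ⊕ (Fin (k + 2) × Fin (k + 2))) → ZMod 2))
    {a : ℝ} (ha : IsThresholdLowerBound (depolarizingFailureFamily (fun k => toricHGPCode k) DX DZ) a) :
    a ≤ 3 / 8 :=
  depolarizingThreshold_le_three_eighths (fun k => toricHGPCode k) toricHGPCode_k_pos DX DZ ha

/-- **`(3/2)·p₀(3) ≤ p_c^depol ≤ 3/8` for the toric codes** under sector-wise minimum-weight decoding — a certified
two-sided interval (`(3/2)·p₀(3) = (3-2√2)/4 ≈ .0429`; numerics: MWPM `≈ .155`, optimal `≈ .189` — VALIDATED values,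
not theorems). [cite: DennisEtAl2002, §4.1 and §4.6] -/
theorem toricHGP_depolarizing_accuracyThreshold_mem
    (DX : ∀ k, Decoder ((Fin (k + 2) × Fin (k + 2)) → ZMod 2)
      (((Fin (k + 2) × Fin (k + 2)) ⊕ (Fin (k + 2) × Fin (k + 2))) → ZMod 2))
    (DZ : ∀ k, Decoder ((Fin (k + 2) × Fin (k + 2)) → ZMod 2)
      (((Fin (k + 2) × Fin (k + 2)) ⊕ (Fin (k + 2) × Fin (k + 2))) → ZMod 2))
    (hDX : ∀ k, (DX k).IsMinWeight (toricHGPCode k).xSyndrome ((toricHGPCode k).kerZ : Set _) hammingNorm)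
    (hDZ : ∀ k, (DZ k).IsMinWeight (toricHGPCode k).zSyndrome ((toricHGPCode k).kerX : Set _) hammingNorm) :
    3 / 2 * thresholdValue 3 ≤ accuracyThreshold (depolarizingFailureFamily (fun k => toricHGPCode k) DX DZ) ∧
      accuracyThreshold (depolarizingFailureFamily (fun k => toricHGPCode k) DX DZ) ≤ 3 / 8 := by
  refine ⟨le_accuracyThreshold (toricHGP_depolarizing_isThresholdLowerBound DX DZ hDX hDZ) ?_,
    depolarizingAccuracyThreshold_le_three_eighths (fun k => toricHGPCode k) toricHGPCode_k_pos DX DZ⟩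
  have := thresholdValue_le_half (3 : ℝ)
  linarith

end Toric

/-! ### Finite size: every sector decoder pair fails with probability `≥ 1/4` at `p = 3/8` -/

section BB

/-- **`[[72,12,6]]`, depolarizing noise, floor**: `1/4 ≤ P^depol_{3/8}` for every pair of sector decoders.
[cite: DennisEtAl2002, §4.1; BravyiEtAl2024, Table 1 row [[72,12,6]]] -/
theorem bb72_quarter_le_depolarizingFailureProb
    (DX DZ : Decoder (BB.Mono 6 6 → ZMod 2) (BB.Mono 6 6 ⊕ BB.Mono 6 6 → ZMod 2)) :
    1 / 4 ≤ BB.bb72.css.depolarizingFailureProb DX DZ (3 / 8) :=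
  BB.bb72.css.quarter_le_depolarizingFailureProb bb72_css_k_pos DX DZ

/-- **`[[144,12,12]]`, depolarizing noise, floor**: `1/4 ≤ P^depol_{3/8}` for every pair of sector decoders.
[cite: DennisEtAl2002, §4.1; BravyiEtAl2024, Table 1 row [[144,12,12]]] -/
theorem bb144_quarter_le_depolarizingFailureProb
    (DX DZ : Decoder (BB.Mono 12 6 → ZMod 2) (BB.Mono 12 6 ⊕ BB.Mono 12 6 → ZMod 2)) :
    1 / 4 ≤ BB.bb144.css.depolarizingFailureProb DX DZ (3 / 8) :=
  BB.bb144.css.quarter_le_depolarizingFailureProb bb144_css_k_pos DX DZ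

end BB

end Summit.Ventures.QEC.Thresholds

end
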